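import Mathlib
import HarnessLib
import Summits.NavierStokesRegularity.NavierStokesRegularity.Theorems.UnthreadedRigidityDoorUnthreadedRigidityVirialHornAnalyticWedge
import Summits.NavierStokesRegularity.NavierStokesRegularity.Theorems.UnthreadedRigidityDoorUnthreadedRigidityVirialHornAngularLemma

/-!
# Route `UnthreadedRigidityDoor`, item `UnthreadedRigidity` (W2, stmt-NavierStokesRegularity-27585) — LINE g11-1 «VIRIAL HORN»:
# BRACKET INJECTIVITY — THE FRAME REDUCTION (linear algebra)

Director KEY-NS #210 (W-i) / dss_155: bridge W `WindowWedgeAnalyticL` is reduced (p712484, `windowWedgeAnalyticL_of_bracketInjective`) to the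
INJECTIVITY OF THE BRACKETS `{B_m, B_{m′}} = det[y, ∇B_m, ∇B_{m′}]` of a linearly independent family of solid harmonics on coefficient arrays:
`(∀ y, Σ_{m,m′} w_{mm′} {B_m,B_{m′}}(y) = 0) → w` symmetric.  This file proves the degree-independent LINEAR ALGEBRA that reduces that statement,
for ALL linearly independent families `B` inside the span of one fixed differentiable frame `F₀,…,F_{d−1}`, to the same statement for the
frame itself (`bracketInjective_of_frame`): write `B_m = Σ_i C_{mi} F_i`; bilinearity and antisymmetry of the bracket give
`Σ_{m,m′} w_{mm′}{B_m,B_{m′}} = Σ_{i,j} (CᵀwC)_{ij} {F_i,F_j}`; the frame statement makes `CᵀwC` symmetric, i.e. `Cᵀ(w − wᵀ)C = 0`, and the rows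
of `C` are linearly independent because the `B_m` are, so `w = wᵀ`.  Ingredients: `gradient_comb` (gradient of a linear combination),
`det3` multilinearity over finite sums, `pbr_comb_comb` (bilinear expansion of the bracket), `linearIndependent_rows_of_comb`.
The per-degree files (`…BracketOne/Two/Three`) supply the frames (coordinates; five traceless quadratic forms; the seven harmonic cubics of
record) and the frame statements by explicit evaluation certificates.

HONEST LABEL: finite-dimensional linear algebra toward ONE hypothesis (`hinj`) of a RUNG line; bridge W as typed (all degrees), `UnthreadedRigidity`
(27585), W2 and NS regularity remain OPEN; nothing here is a statement about Navier–Stokes solutions.  `--supports stmt-NavierStokesRegularity-27585`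
(helper); ns-crc-p2 g9.  [folklore]
-/

-- the summit and its single sub-problem share the name (CONVENTIONS §1)
set_option linter.dupNamespace false

namespace Summit.NavierStokesRegularity.NavierStokesRegularity.Theorems.UnthreadedRigidity.VirialHorn

open scoped Topology
open Filter Set
open Summit.NavierStokesRegularity.NavierStokesRegularity.Theorems.UnthreadedRigidity.ProfileHorn (E3)

/-! ## Multilinearity of `det3` and bilinearity of the bracket -/

/-- `det3` is additive in the middle argument. -/
theorem det3_add_mid (y v₁ v₂ w : E3) : det3 y (v₁ + v₂) w = det3 y v₁ w + det3 y v₂ w := by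
  simp only [det3, PiLp.add_apply]
  ring

/-- `det3` is homogeneous in the middle argument. -/
theorem det3_smul_mid (y v w : E3) (c : ℝ) : det3 y (c • v) w = c * det3 y v w := by
  simp only [det3, PiLp.smul_apply, smul_eq_mul]
  ring

/-- `det3` vanishes when the middle argument is zero. -/
theorem det3_zero_mid (y w : E3) : det3 y 0 w = 0 := by
  simp [det3]

/-- `det3` vanishes when the last argument is zero. -/
theorem det3_zero_right (y v : E3) : det3 y v 0 = 0 := by
  simp [det3]

/-- `det3` is antisymmetric in its last two arguments. -/
theorem det3_swap (y v w : E3) : det3 y w v = -det3 y v w := by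
  simp only [det3]
  ring

/-- `det3` over a finite linear combination in the middle argument. -/
theorem det3_sum_smul_mid {ι : Type*} (s : Finset ι) (y w : E3) (a : ι → ℝ) (u : ι → E3) :
    det3 y (∑ i ∈ s, a i • u i) w = ∑ i ∈ s, a i * det3 y (u i) w := by
  classical
  induction s using Finset.induction_on with
  | empty => simp [det3_zero_mid]
  | insert j s hj ih => rw [Finset.sum_insert hj, Finset.sum_insert hj, det3_add_mid, det3_smul_mid, ih]

/-- `det3` over a finite linear combination in the last argument. -/
theorem det3_sum_smul_right {ι : Type*} (s : Finset ι) (y v : E3) (a : ι → ℝ) (u : ι → E3) :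
    det3 y v (∑ i ∈ s, a i • u i) = ∑ i ∈ s, a i * det3 y v (u i) := by
  rw [det3_swap, det3_sum_smul_mid, ← Finset.sum_neg_distrib]
  refine Finset.sum_congr rfl fun i _ => ?_
  rw [det3_swap]
  ring

/-- the gradient of a linear combination of differentiable functions is the linear combination of the gradients. -/
theorem gradient_comb {d : ℕ} (c : Fin d → ℝ) (F : Fin d → E3 → ℝ) (hF : ∀ i, Differentiable ℝ (F i)) (y : E3) :
    gradient (fun z => ∑ i, c i * F i z) y = ∑ i, c i • gradient (F i) y := by
  have hderiv : HasFDerivAt (fun z => ∑ i, c i * F i z) (∑ i, c i • fderiv ℝ (F i) y) y :=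
    HasFDerivAt.fun_sum fun i _ => ((hF i) y).hasFDerivAt.const_mul (c i)
  have hgrad : HasGradientAt (fun z => ∑ i, c i * F i z) (∑ i, c i • gradient (F i) y) y := by
    rw [hasGradientAt_iff_hasFDerivAt]
    refine hderiv.congr_fderiv ?_
    simp only [map_sum, map_smul, gradient, LinearIsometryEquiv.apply_symm_apply]
  exact hgrad.gradient

/-- BILINEAR EXPANSION OF THE BRACKET over a differentiable frame:
`{Σ_i a_i F_i, Σ_j b_j F_j} = Σ_i Σ_j a_i b_j {F_i, F_j}`. -/
theorem pbr_comb_comb {d : ℕ} (F : Fin d → E3 → ℝ) (hF : ∀ i, Differentiable ℝ (F i)) (a b : Fin d → ℝ) (y : E3) :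
    pbr (fun z => ∑ i, a i * F i z) (fun z => ∑ j, b j * F j z) y = ∑ i, ∑ j, a i * b j * pbr (F i) (F j) y := by
  unfold pbr
  rw [gradient_comb a F hF y, gradient_comb b F hF y, det3_sum_smul_mid]
  refine Finset.sum_congr rfl fun i _ => ?_
  rw [det3_sum_smul_right, Finset.mul_sum]
  refine Finset.sum_congr rfl fun j _ => ?_
  ring

/-! ## Rows of the coefficient matrix of an independent family are independent -/

/-- If `B_m = Σ_i C_{mi} F_i` pointwise and the family `B` is linearly independent, then the rows of `C` are linearly independent. -/
theorem linearIndependent_rows_of_comb {d n : ℕ} (F : Fin d → E3 → ℝ) {B : Fin n → E3 → ℝ} (hB : LinearIndependent ℝ B)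
    (C : Fin n → Fin d → ℝ) (hBC : ∀ m y, B m y = ∑ i, C m i * F i y) : LinearIndependent ℝ (fun m => C m) := by
  rw [Fintype.linearIndependent_iff] at hB ⊢
  intro g hg
  apply hB g
  funext y
  have hcoef : ∀ i, ∑ m, g m * C m i = 0 := fun i => by
    have := congrFun hg i
    simpa [Finset.sum_apply, Pi.smul_apply, smul_eq_mul] using this
  simp only [Finset.sum_apply, Pi.smul_apply, smul_eq_mul, Pi.zero_apply]
  calc ∑ m, g m * B m y = ∑ m, ∑ i, g m * C m i * F i y := by
        refine Finset.sum_congr rfl fun m _ => ?_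
        rw [hBC m y, Finset.mul_sum]
        refine Finset.sum_congr rfl fun i _ => ?_
        ring
    _ = ∑ i, (∑ m, g m * C m i) * F i y := by
        rw [Finset.sum_comm]
        refine Finset.sum_congr rfl fun i _ => ?_
        rw [Finset.sum_mul]
    _ = 0 := by simp [hcoef]

/-! ## ★ The frame reduction -/

/-- exchanging a double outer summation with a double inner summation. -/
theorem sum_comm_four {d n : ℕ} (g : Fin d → Fin d → Fin n → Fin n → ℝ) :
    ∑ i, ∑ j, ∑ m, ∑ m', g i j m m' = ∑ m, ∑ m', ∑ i, ∑ j, g i j m m' := by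
  calc ∑ i, ∑ j, ∑ m, ∑ m', g i j m m' = ∑ i, ∑ m, ∑ j, ∑ m', g i j m m' :=
        Finset.sum_congr rfl fun i _ => Finset.sum_comm
    _ = ∑ m, ∑ i, ∑ j, ∑ m', g i j m m' := Finset.sum_comm
    _ = ∑ m, ∑ i, ∑ m', ∑ j, g i j m m' :=
        Finset.sum_congr rfl fun m _ => Finset.sum_congr rfl fun i _ => Finset.sum_comm
    _ = ∑ m, ∑ m', ∑ i, ∑ j, g i j m m' := Finset.sum_congr rfl fun m _ => Finset.sum_comm

/-- ★ BRACKET INJECTIVITY: FRAME REDUCTION.  Let `F₀,…,F_{d−1}` be differentiable functions whose brackets are injective on coefficient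
arrays in the symmetric form `(∀ y, Σ_{i,j} a_{ij}{F_i,F_j}(y) = 0) → a` symmetric.  Then every linearly independent family `B` in the span
of the frame (`B_m = Σ_i C_{mi}F_i`) has the same property: `(∀ y, Σ_{m,m′} w_{mm′}{B_m,B_{m′}}(y) = 0) → w` symmetric. -/
theorem bracketInjective_of_frame {d : ℕ} (F : Fin d → E3 → ℝ) (hF : ∀ i, Differentiable ℝ (F i))
    (hframe : ∀ a : Fin d → Fin d → ℝ, (∀ y : E3, ∑ i, ∑ j, a i j * pbr (F i) (F j) y = 0) → ∀ i j, a i j = a j i)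
    {n : ℕ} {B : Fin n → E3 → ℝ} (hB : LinearIndependent ℝ B) (C : Fin n → Fin d → ℝ)
    (hBC : ∀ m y, B m y = ∑ i, C m i * F i y)
    (w : Fin n → Fin n → ℝ) (hw : ∀ y : E3, ∑ m, ∑ m', w m m' * pbr (B m) (B m') y = 0) : ∀ m m', w m m' = w m' m := by
  -- the brackets of the family in terms of the frame
  have hBfun : ∀ m, B m = fun z => ∑ i, C m i * F i z := fun m => funext (hBC m)
  have hpair : ∀ m m' (y : E3), pbr (B m) (B m') y = ∑ i, ∑ j, C m i * C m' j * pbr (F i) (F j) y := by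
    intro m m' y
    rw [hBfun m, hBfun m']
    exact pbr_comb_comb F hF (C m) (C m') y
  -- the congruent array `a = Cᵀ w C`
  set a : Fin d → Fin d → ℝ := fun i j => ∑ m, ∑ m', w m m' * (C m i * C m' j) with ha
  have hzero : ∀ y : E3, ∑ i, ∑ j, a i j * pbr (F i) (F j) y = 0 := by
    intro y
    have h := hw y
    simp only [hpair, Finset.mul_sum] at h
    calc ∑ i, ∑ j, a i j * pbr (F i) (F j) y
        = ∑ i, ∑ j, ∑ m, ∑ m', w m m' * (C m i * C m' j) * pbr (F i) (F j) y := by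
          simp only [ha, Finset.sum_mul]
      _ = ∑ m, ∑ m', ∑ i, ∑ j, w m m' * (C m i * C m' j * pbr (F i) (F j) y) := by
          rw [sum_comm_four]
          simp only [mul_assoc]
      _ = 0 := h
  have hsym : ∀ i j, a i j = a j i := hframe a hzero
  -- rows of `C` are independent
  have hrows := linearIndependent_rows_of_comb F hB C hBC
  rw [Fintype.linearIndependent_iff] at hrows
  -- `Cᵀ (w − wᵀ) C = 0`
  have hanti : ∀ i j, ∑ m, ∑ m', (w m m' - w m' m) * (C m i * C m' j) = 0 := by
    intro i j
    have h1 := hsym i j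
    simp only [ha] at h1
    have h2 : ∑ m, ∑ m', w m m' * (C m j * C m' i) = ∑ m, ∑ m', w m' m * (C m i * C m' j) := by
      rw [Finset.sum_comm (f := fun m m' => w m m' * (C m j * C m' i))]
      refine Finset.sum_congr rfl fun m _ => Finset.sum_congr rfl fun m' _ => ?_
      ring
    rw [h2] at h1
    simp only [sub_mul, Finset.sum_sub_distrib]
    linarith
  -- first elimination: for each `j`, the vector `u_m = Σ_{m′} (w_{mm′} − w_{m′m}) C_{m′j}` vanishes
  have hu : ∀ j m, ∑ m', (w m m' - w m' m) * C m' j = 0 := by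
    intro j
    have key := hrows (fun m => ∑ m', (w m m' - w m' m) * C m' j) ?_
    · exact key
    · funext i
      simp only [Finset.sum_apply, Pi.smul_apply, smul_eq_mul, Pi.zero_apply]
      rw [← hanti i j]
      refine Finset.sum_congr rfl fun m _ => ?_
      rw [Finset.sum_mul]
      refine Finset.sum_congr rfl fun m' _ => ?_
      ring
  -- second elimination: for each `m`, the coefficients `w_{mm′} − w_{m′m}` vanish
  intro m m'
  have key := hrows (fun m' => w m m' - w m' m) ?_
  · exact sub_eq_zero.mp (key m')
  · funext j
    simp only [Finset.sum_apply, Pi.smul_apply, smul_eq_mul, Pi.zero_apply]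
    exact hu j m

end Summit.NavierStokesRegularity.NavierStokesRegularity.Theorems.UnthreadedRigidity.VirialHorn
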